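import Summits.FinalStateConjecture.FinalStateConjecture.Theorems.ChannelsResolveTameDevelopmentsR.Negative.SubMinkowskiPastCut
import HarnessLib

/-!
# Φ″ WITHOUT `IsMaximal` STILL HOLDS on the flat model class after the T2 re-type — support for the crux
# `ChannelsResolveTameDevelopmentsR` (K2R ≡ Φ, item `stmt-FinalStateConjecture-14075`, route
# PhotonSphereChannels), load-bearing analysis on the certifiable model class, part 5 (session 22)

On 2026-08-16T21:18Z the summit statement was re-typed (semantic-vacuity audit, re-type T2): the
post-maximality conclusion gained the intrinsic lower bound `RaysStayInClosure 𝒟 O` on the settled region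
and the chart orientation `IsFutureOriented d`, and `HasExhaustiveCharts` now carries honest radii. Parts
3–4 (`SubMinkowskiSettled`, `SubMinkowskiPastCut`) proved, for the open sub-developments `η|_U` of the
trivial datum: complete `𝓘⁺` ⟹ `{x⁰ ≥ 0} ⊆ U` ⟹ the future half-space `O = {x⁰ ≥ 0}` carries the honest
exhaustive `N = 0` decomposition `subDecomp` — "Φ without `IsMaximal`" is TRUE on the certifiable class, and
non-vacuously so (the past cut `{x⁰ > −1}` is complete, settled and NOT maximal).

This part carries that census over to the re-typed conclusion (Φ″):

* `raysStayInClosure_futureSet` — every normalised future null ray of `η|_U` from the slice is a straight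
  null line with unit time component (`geodesic_affine`, normalisation `η(γ'(0), ∂ₜ) = −1`), so it stays
  in `O = {x⁰ ≥ 0}` for parameters `t ≥ 0` — whatever `U` is;
* `isFutureOriented_subDecomp` — the inclusion flat chart `{x⁰ > 0} ↪ U` pushes `∂₀` forward to `∂ₜ|_U`,
  future-directed for `(η|_U, ∂ₜ|_U)`; the hole clauses are vacuous;
* `settlesT2_of_future_subset`, `settlesT2_of_hasCompleteNullInfinity` — **Φ″ without `IsMaximal` on the
  flat class**: a sojourn-complete `η|_U` satisfies the full re-typed conclusion
  `∃ O d, (∀ i, IsSubextremal) ∧ O = exteriorOf ∧ RaysStayInClosure ∧ HasExhaustiveCharts ∧ IsFutureOriented`;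
* `exists_complete_settledT2_not_isMaximal` — non-vacuity: the past cut is complete, T2-settled, not maximal.

So the re-type changes nothing in the load-bearing picture on the certifiable class: complete `𝓘⁺` is the
structural hypothesis that does the work, `IsMaximal` stays idle, and the two new clauses are satisfied by
the same honest decomposition. All results proved; no named facts.

## References

* B. O'Neill, *Semi-Riemannian geometry* (1983), Ch. 3, Cor. 21 and Example 25; Ch. 5, p. 145.
* D. Christodoulou, S. Klainerman, *The global nonlinear stability of the Minkowski space* (1993), Thm. 1.0.2.
* M. Dafermos, J. Luk, arXiv:1710.01722, Conjecture 1.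
* H. Ringström, *The Cauchy problem in general relativity* (2009), Def. 16.5 (MGHD).
-/

noncomputable section

open Bundle Set Function Filter TopologicalSpace Topology MeasureTheory Metric
open scoped Manifold ContDiff Topology ENNReal

set_option linter.dupNamespace false

namespace Summit.FinalStateConjecture.FinalStateConjecture.Theorems.ChannelsResolveTameDevelopmentsR.SubMinkowski

open Literature.Geometry.Lorentzian Literature.Geometry.Lorentzian.Minkowski

section Decomposition

variable {U : Opens E4} {hU : IsConnected (U : Set E4)} {hsl : ∀ y : slice, sliceEmbed y ∈ U}
  {hC : (subMetric U).IsCauchyHypersurface (subOrientation U)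
    (range (vacuumCauchyDevelopment.embedOpens U hsl))}

/-- **Every normalised future null ray of `η|_U` from the slice stays in `O = {x⁰ ≥ 0}`** (hence in its
closure), for EVERY open sub-development `U`: the ray is straight, `γ(t) = γ(0) + t v` on its domain
(`geodesic_affine`), starts on the slice `{x⁰ = 0}`, and the normalisation `η(v, ∂ₜ) = −1` is `v⁰ = 1`, so
`(γ t)⁰ = t ≥ 0` for `t ≥ 0`. The new intrinsic lower bound `RaysStayInClosure` of the T2 summit statement
holds on the whole flat class (complete or not). [cite: DafermosLuk2017, Conjecture 1] -/
theorem raysStayInClosure_futureSet :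
    _root_.Summit.FinalStateConjecture.RaysStayInClosure (subDev U hU hsl hC).toCauchyDevelopment
      (futureSet U) := by
  intro hLC y γ dom hray _hunb t ht ht0
  haveI : (subMetric U).toPseudoRiemannianMetric.HasLeviCivita := hLC
  -- view the ray as a curve of the open submanifold `U`
  change ℝ → U at γ
  obtain ⟨hmax, h0, hγ0, -, -, hnorm⟩ := hray
  change IsMaximalGeodesicOn (subMetric U).toPseudoRiemannianMetric.leviCivita γ dom at hmax
  obtain ⟨v, hv, -, hline⟩ := geodesic_affine hmax.isGeodesicOn hmax.isOpen hmax.2.1 h0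
  -- normalisation: `v⁰ = 1`
  have hv0 : v 0 = 1 := by
    have h' : bilin (velocity 𝓘(ℝ, E4) γ 0) (E4.basisVector 0) = -1 := hnorm
    rw [hv, bilin_symm, bilin_basisVector_zero_left] at h'
    linarith
  refine subset_closure ?_
  show (0 : ℝ) ≤ ((γ t : U) : E4) 0
  rw [hline t ht]
  have h00 : (γ 0 : E4) 0 = 0 := by rw [hγ0]; rfl
  have : ((γ 0 : E4) + t • v) 0 = (γ 0 : E4) 0 + t * v 0 := by simp
  rw [this, h00, hv0]
  linarith

/-- **The inclusion flat chart of `subDecomp` is future-oriented**: no hole (orthochronous-motion and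
near-zone clauses vacuous), and at every point of every flat slab the push-forward of `∂₀` under the
inclusion `{x⁰ > 0} ↪ U` is `∂ₜ|_U` (`OpensChart.mfderiv_inclusion_apply`), the future-directed field of
the time orientation of `η|_U` itself. [cite: arXiv08110354, §5.1] -/
theorem isFutureOriented_subDecomp (hfut : {x : E4 | 0 ≤ x 0} ⊆ (U : Set E4)) :
    _root_.Summit.FinalStateConjecture.IsFutureOriented
      (subDecomp (hU := hU) (hsl := hsl) (hC := hC) hfut) := by
  refine ⟨fun i ↦ i.elim0, fun i ↦ i.elim0, ?_⟩
  change ∀ᶠ τ in atTop, ∀ x ∈ (Minkowski.backgroundOn flatDom).timeSlab τ,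
    (subDev U hU hsl hC).timeOrientation.IsFutureDirected
      (mfderiv 𝓘(ℝ, E4) (𝓡 4) (Opens.inclusion (flatDom_le hfut)) x (E4.basisVector 0))
  refine Filter.Eventually.of_forall fun τ x _ ↦ ?_
  rw [show mfderiv 𝓘(ℝ, E4) (𝓡 4) (Opens.inclusion (flatDom_le hfut)) x (E4.basisVector 0) =
      E4.basisVector 0 from OpensChart.mfderiv_inclusion_apply (flatDom_le hfut) x (E4.basisVector 0)]
  exact (subDev U hU hsl hC).timeOrientation.isFutureDirected_vectorField _

/-- **If `{x⁰ ≥ 0} ⊆ U`, the sub-development `η|_U` SETTLES IN THE T2 SENSE**: the future half-space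
`O = {x⁰ ≥ 0}` carries an honest (`O = exteriorOf`), ray-containing, exhaustive, future-oriented,
(vacuously) sub-extremal final-state `2`-decomposition (`N = 0`) — verbatim the re-typed post-maximality
conclusion of the summit, minus complete `𝓘⁺`. [cite: ChristodoulouKlainerman1993, Thm. 1.0.2] -/
theorem settlesT2_of_future_subset (hfut : {x : E4 | 0 ≤ x 0} ⊆ (U : Set E4)) :
    ∃ (O : Set (subDev U hU hsl hC).carrier)
      (d : FinalStateDecomposition (subDev U hU hsl hC).toSpacetime O 2),
      (∀ i, Kerr.IsSubextremal (d.mass i) (d.spin i)) ∧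
        O = _root_.Summit.FinalStateConjecture.exteriorOf (subDev U hU hsl hC).toCauchyDevelopment d.charted ∧
          _root_.Summit.FinalStateConjecture.RaysStayInClosure (subDev U hU hsl hC).toCauchyDevelopment O ∧
            _root_.Summit.FinalStateConjecture.HasExhaustiveCharts d ∧
              _root_.Summit.FinalStateConjecture.IsFutureOriented d :=
  ⟨futureSet U, subDecomp hfut, fun i ↦ i.elim0, futureSet_eq_exteriorOf hfut,
    raysStayInClosure_futureSet, hasExhaustiveCharts_subDecomp hfut, isFutureOriented_subDecomp hfut⟩

/-- **Φ″ WITHOUT `IsMaximal` HOLDS ON THE FLAT MODEL CLASS — from completeness alone, also after the T2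
re-type.** Every open sub-development `η|_U` of the trivial datum whose future null infinity is complete in
the sojourn sense satisfies the full re-typed conclusion: completeness forces `{x⁰ ≥ 0} ⊆ U`
(`hasCompleteNullInfinity_iff_future_subset`) and the future half-space settles in the T2 sense
(`settlesT2_of_future_subset`). With `slab_fails_both_deleted_hypotheses` /
`not_tameResolution_allDevelopments` (Φ with BOTH `IsMaximal` and completeness deleted is false on the same
class) the load-bearing picture of K2R ≡ Φ on the certifiable class is unchanged by the re-type: complete
`𝓘⁺` does the work, `IsMaximal` is idle, and the two new clauses come for free with the honest
decomposition. [cite: Christodoulou1999, pp. A26–A27] -/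
theorem settlesT2_of_hasCompleteNullInfinity
    (h : _root_.Summit.FinalStateConjecture.HasCompleteNullInfinity (subDev U hU hsl hC).toCauchyDevelopment) :
    ∃ (O : Set (subDev U hU hsl hC).carrier)
      (d : FinalStateDecomposition (subDev U hU hsl hC).toSpacetime O 2),
      (∀ i, Kerr.IsSubextremal (d.mass i) (d.spin i)) ∧
        O = _root_.Summit.FinalStateConjecture.exteriorOf (subDev U hU hsl hC).toCauchyDevelopment d.charted ∧
          _root_.Summit.FinalStateConjecture.RaysStayInClosure (subDev U hU hsl hC).toCauchyDevelopment O ∧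
            _root_.Summit.FinalStateConjecture.HasExhaustiveCharts d ∧
              _root_.Summit.FinalStateConjecture.IsFutureOriented d :=
  settlesT2_of_future_subset (hasCompleteNullInfinity_iff_future_subset.1 h)

end Decomposition

/-- **THE FLAT CLASS CONTAINS COMPLETE, T2-SETTLED, NON-MAXIMAL DEVELOPMENTS** (non-vacuity of "Φ″ without
`IsMaximal`"): the past cut `{x⁰ > −1}` of Minkowski space is a vacuum Cauchy development of the admissible
trivial datum which is NOT maximal (`pastCutDev_not_isMaximal`), has complete `𝓘⁺` and satisfies the full
re-typed post-maximality conclusion. [cite: Ringstrom2009, Def. 16.5] -/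
theorem exists_complete_settledT2_not_isMaximal :
    ∃ 𝒟 : VacuumCauchyDevelopment trivialData, ¬ 𝒟.IsMaximal ∧
      _root_.Summit.FinalStateConjecture.HasCompleteNullInfinity 𝒟.toCauchyDevelopment ∧
        ∃ (O : Set 𝒟.carrier) (d : FinalStateDecomposition 𝒟.toSpacetime O 2),
          (∀ i, Kerr.IsSubextremal (d.mass i) (d.spin i)) ∧
            O = _root_.Summit.FinalStateConjecture.exteriorOf 𝒟.toCauchyDevelopment d.charted ∧
              _root_.Summit.FinalStateConjecture.RaysStayInClosure 𝒟.toCauchyDevelopment O ∧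
                _root_.Summit.FinalStateConjecture.HasExhaustiveCharts d ∧
                  _root_.Summit.FinalStateConjecture.IsFutureOriented d :=
  ⟨pastCutDev, pastCutDev_not_isMaximal, hasCompleteNullInfinity_pastCutDev,
    settlesT2_of_hasCompleteNullInfinity hasCompleteNullInfinity_pastCutDev⟩

end Summit.FinalStateConjecture.FinalStateConjecture.Theorems.ChannelsResolveTameDevelopmentsR.SubMinkowski

end
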